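import Summits.BirchSwinnertonDyer.BirchSwinnertonDyer.Theorems.KolyvaginDepthDoorMSymbolCert817a1K
import HarnessLib

/-!
# Route `KolyvaginDepthDoor`, crux `KolyvaginDepthSupplyKN` (stmt-BirchSwinnertonDyer-22820) —
# DEPTH TABLE v28, DATA of `817a1`: SMALL piece 3/4 of the Kurihara sum (re-cut for the farm's per-module build budget)

Helper file of the lead prover of line `levelone` (kdd-p1 g33; `--supports stmt-BirchSwinnertonDyer-22820 --as helper`);
MACHINE-WRITTEN (generator `work/py/gensmall.py`). Kernel evaluation of `∑_{11534 ≤ k < 12431} gE817 k` (106406 continued-fraction steps,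
two `decide` sub-chunks); the `4` small pieces replace the earlier larger pieces as imports of the assembled E-side claim (those stay valid but
were too heavy for some farm nodes to rebuild). It closes nothing and BSD is NOT proved by it.

References: [Kim2022StructureSelmer] §1.4.3; [CremonaAlgorithms1997] §2.2–2.5.
-/

set_option linter.dupNamespace false
-- the packed numerals are long literals
set_option linter.style.longLine false

noncomputable section

open scoped MatrixGroups ModularForm
open CongruenceSubgroup
open Literature.NumberTheory.EllipticCurves Literature.NumberTheory.EllipticCurves.ModularForms
open Literature.NumberTheory.Automorphic.PopaZagier (coeff12 coeff12M coeff coeffN)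
open Summit.BirchSwinnertonDyer.BirchSwinnertonDyer.Rank2Observatory
open Summit.BirchSwinnertonDyer.BirchSwinnertonDyer.Rank1Residual (IntModel.frobeniusTrace_eq IntModel.minimalDiscriminantInt_eq)
open Summit.BirchSwinnertonDyer.BirchSwinnertonDyer.Theorems.KolyvaginDepthDoor.MSymbolCert.Cert389a1
  (H3 H3fin support_subset_H3fin H3fin_det H3mat_nodup H3_det H3_coeff eval_map eval_append)

namespace Summit.BirchSwinnertonDyer.BirchSwinnertonDyer.Theorems.KolyvaginDepthDoor.MSymbolCert.Cert817a1

set_option maxHeartbeats 4000000 in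
/-- **Small piece 3 of the Kurihara sum of `817a1`**: `∑_{11534 ≤ k < 12431} gE817 k = 2` in `ZMod 5` (decide). [cite: Kim2022StructureSelmer, §1.4.3] -/
theorem kSumS3 : ((List.range' 11534 897).map gE817).sum = ((2 : ℕ) : ZMod 5) := by
  have h0 : ((List.range' 11534 857).map gE817).sum = ((4 : ℕ) : ZMod 5) := by decide +kernel
  have h1 : ((List.range' (11534 + 857) 40).map gE817).sum = ((3 : ℕ) : ZMod 5) := by decide +kernel
  refine (show ((List.range' 11534 897).map gE817).sum = ((List.range' 11534 (857 + 40)).map gE817).sum from rfl).trans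
    ((zmod5_range'_map_sum_split gE817 11534 857 40 _ _ h0 h1).trans ?_)
  decide

end Summit.BirchSwinnertonDyer.BirchSwinnertonDyer.Theorems.KolyvaginDepthDoor.MSymbolCert.Cert817a1

end
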